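import Mathlib
import Literature.MathematicalPhysics.QuantumLattice.LatticeGaugeDLR
import Literature.MathematicalPhysics.QuantumFieldTheory.YangMillsOS
import Summits.QuantumFields.YangMills.Theses.HyperbolicRegulator

/-!
# Crux-ideate sketch (round 1, ideator 1) for `CurvatureUniformityR` (stmt-QuantumFields-18154)

First-lemma statements for two crux idea cards (statements only; nothing here is an item):

* **Card A `toll-gate-localisation`** — `InChartUniformityR` (the crux's clustering predicate restricted to
  IN-CHART pairs `Γ.dist x y + Γ.dist x' y' ≤ k/16`, the only pairs `HyperbolicToTorusR` consumes),
  `FlatBoxWeakMixingDeep`, `FlatBoxStrongMixingDeep` (flat `ℤ⁴` Wilson boxes, uniform in the boundary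
  condition; Martinelli WM / SMT restricted to deep observables) and the line statement `TollGateReduction`.
* **Card B `hilbertian-shells`** — `SDPITwoStep` (strong data processing along a Markov triple, pure measure
  theory) and the flat window `FlatShellFloor` (shape-free maximal-correlation floor across thick shells), with
  the line statement `ShellChainGivesSMT`.
-/

set_option autoImplicit false

noncomputable section

namespace Summit.QuantumFields.YangMills.Cruxes.CurvatureUniformityR.Ideate1

open MeasureTheory ProbabilityTheory
open Literature.MathematicalPhysics.QuantumLattice Literature.MathematicalPhysics.QuantumFieldTheory
open Literature.Probability.LatticeModels

/-! ## Card A — toll-gate localisation -/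

/-- **In-chart uniformity**: `CurvatureUniformityR` verbatim except that the clustering predicate only quantifies over
IN-CHART pairs, `Γ.dist x y + Γ.dist x' y' ≤ k / 16` (one inserted hypothesis; everything else byte-identical). -/
def InChartUniformityR : Prop :=
  open Literature.MathematicalPhysics.QuantumFieldTheory Literature.MathematicalPhysics.QuantumLattice MeasureTheory in ∀ (G : Type) [Group G] [TopologicalSpace G] [IsTopologicalGroup G] [CompactSpace G], IsCompactSimpleLieGroup G → letI : MeasurableSpace G := borel G; haveI : BorelSpace G := ⟨rfl⟩; ∀ r : LatticeRep G, let Fam := fun (k j : ℕ) (V E Q : Finset ℕ) (σ τ : ℕ → ℕ) (bd : ℕ → Fin 4 → ℕ × Bool) (cV : ℕ → ℤ × ℤ → ℕ) (cE : ℕ → ℤ × ℤ → Fin 2 → ℕ × Bool) => let st := fun e : ℕ × Bool => if e.2 then σ e.1 else τ e.1; let en := fun e : ℕ × Bool => if e.2 then τ e.1 else σ e.1; let Γ := SimpleGraph.fromRel fun a b : ℕ => ∃ e ∈ E, σ e = a ∧ τ e = b; let dg := fun x : ℕ => (E.filter fun e => σ e = x ∨ τ e = x).card; let K := V.filter fun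 x => dg x = 5; let F := fun x : ℕ => x ∈ V ∧ ∀ c ∈ K, k / 2 < Γ.dist x c; let Dp := fun x : ℕ => x ∈ V ∧ ∀ c ∈ K, 3 * (k / 4) < Γ.dist x c; let ib := fun a : ℤ × ℤ => |a.1| ≤ (k : ℤ) / 4 ∧ |a.2| ≤ (k : ℤ) / 4; let nx := fun (a : ℤ × ℤ) (μ : Fin 2) => if μ = 0 then (a.1 + 1, a.2) else (a.1, a.2 + 1); let Ed := (ℕ × ℕ) ⊕ (ℕ × ℕ); let PE : Finset Ed := (E ×ˢ V).disjSum (V ×ˢ E); let Cfg := ↥PE → G; let ν := Measure.pi fun _ : ↥PE => haarProbability G; let v := fun (U : Cfg) (e : Ed × Bool) => if h : e.1 ∈ PE then (if e.2 then U ⟨e.1, h⟩ else (U ⟨e.1, h⟩)⁻¹) else 1; let w := fun (U : Cfg) (e : Fin 4 → Ed × Bool) => (r.ρ (v U (e 0) * v U (e 1) * v U (e 2) * v U (e 3))).trace.re; let S := fun U : Cfg => (∑ q ∈ Q, ∑ y ∈ V, w U fun i => (Sum.inl ((bd q i).1, y), (bd q i).2)) + (∑ y ∈ V, ∑ q ∈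 Q, w U fun i => (Sum.inr (y, (bd q i).1), (bd q i).2)) + ∑ e ∈ E, ∑ e' ∈ E, w U ![(Sum.inl (e, σ e'), true), (Sum.inr (τ e, e'), true), (Sum.inl (e, τ e'), false), (Sum.inr (σ e, e'), false)]; let d0 : Fin 4 → Fin 2 := ![0, 1, 0, 1]; let P := fun (x x' : ℕ) (U : Cfg) (p : ZdEdge 4) => let a := (p.1 0, p.1 1); let b := (p.1 2, p.1 3); if p.2 = 0 ∨ p.2 = 1 then v U (Sum.inl ((cE x a (d0 p.2)).1, cV x' b), (cE x a (d0 p.2)).2) else v U (Sum.inr (cV x a, (cE x' b (d0 p.2)).1), (cE x' b (d0 p.2)).2); ((∀ e ∈ E, σ e ∈ V ∧ τ e ∈ V ∧ σ e ≠ τ e) ∧ (∀ q ∈ Q, (∀ i, (bd q i).1 ∈ E) ∧ (∀ i, en (bd q i) = st (bd q (i + 1))) ∧ (st ∘ bd q).Injective) ∧ (∀ e ∈ E, (Q.filter fun q => ∃ i, (bd q i).1 = e).card = 2) ∧ (∀ x ∈ V, (dg x = 4 ∨ dg x = 5) ∧ (Q.filter fun q => ∃ i, st (bd q i) = x).card =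 dg x) ∧ (∀ x ∈ V, ∃ c ∈ K, Γ.dist x c ≤ k) ∧ (∀ c ∈ K, ∀ c' ∈ K, c ≠ c' → k ≤ Γ.dist c c') ∧ (∀ f : ℕ → ℝ, ∑ x ∈ V, f x = 0 → ∑ x ∈ V, f x ^ 2 ≤ 10 ^ 6 * (k : ℝ) ^ 2 * ∑ e ∈ E, (f (σ e) - f (τ e)) ^ 2) ∧ (∃ x y, Dp x ∧ Dp y ∧ j ≤ Γ.dist x y) ∧ (∀ x, F x → cV x (0, 0) = x ∧ (∀ a, ib a → cV x a ∈ V) ∧ Set.InjOn (cV x) {a | ib a} ∧ (∀ a μ, ib a → ib (nx a μ) → (cE x a μ).1 ∈ E ∧ st (cE x a μ) = cV x a ∧ en (cE x a μ) = cV x (nx a μ)) ∧ (∀ a, ib a → ib (a.1 + 1, a.2 + 1) → ∃ q ∈ Q, Finset.univ.image (Prod.fst ∘ bd q) = {(cE x a 0).1, (cE x (nx a 0) 1).1, (cE x (nx a 1) 0).1, (cE x a 1).1})), fun (β m C : ℝ) (A B : YMSpecies G) => let X := fun f : Cfg → ℝ => (∫ U, f U * Real.exp (β * S U) ∂ν)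 / (∫ U, Real.exp (β * S U) ∂ν); ∀ x x' y y', F x → F x' → F y → F y' → Γ.dist x y + Γ.dist x' y' ≤ k / 16 → |X (fun U => A.F (P x x' U) * B.F (P y y' U)) - X (fun U => A.F (P x x' U)) * X (fun U => B.F (P y y' U))| ≤ C * Real.exp (-(m * ((Γ.dist x y + Γ.dist x' y' : ℕ) : ℝ)))); let Sp := fun (A : YMSpecies G) (R : ℕ) => ∀ p ∈ A.supp, ∀ i, |p.1 i| ≤ (R : ℤ); ∀ (V E Q : ℕ → ℕ → Finset ℕ) (σ τ : ℕ → ℕ → ℕ → ℕ) (bd : ℕ → ℕ → ℕ → Fin 4 → ℕ × Bool) (cV : ℕ → ℕ → ℕ → ℤ × ℤ → ℕ) (cE : ℕ → ℕ → ℕ → ℤ × ℤ → Fin 2 → ℕ × Bool), let Φ := fun k j => Fam k j (V k j) (E k j) (Q k j) (σ k j) (τ k j) (bd k j) (cV k j) (cE k j); (∀ k j, 8 ≤ k → (Φ k j).1) → (∃ c : ℝ, 0 < c ∧ ∀ k, 8 ≤ k → ∃ β₀ : ℝ, ∀ β, β₀ ≤ β → ∀ A B : YMSpecies G, Sp A (k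 / 8) → Sp B (k / 8) → ∃ C j₀, ∀ j, j₀ ≤ j → (Φ k j).2 β (c / k) C A B) → (∃ β₁ : ℝ, ∀ β, β₁ ≤ β → ∃ m : ℝ, 0 < m ∧ ∀ A B : YMSpecies G, ∃ C : ℝ, ∃ K : ℕ, ∀ k, K ≤ k → Sp A (k / 8) → Sp B (k / 8) → ∃ j₀ : ℕ, ∀ j, j₀ ≤ j → (Φ k j).2 β m C A B)

/-- Sites of the sup-box `[-L, L]⁴`. -/
def boxSites (L : ℕ) : Finset (Site 4) := Fintype.piFinset fun _ => Finset.Icc (-(L : ℤ)) L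

/-- Edges of the sup-box `[-L, L]⁴` (both endpoints in the box). -/
def boxEdges (L : ℕ) : Finset (ZdEdge 4) :=
  (boxSites L ×ˢ (Finset.univ : Finset (Fin 4))).filter fun e => e.1 e.2 + 1 ≤ (L : ℤ)

/-- **Flat weak mixing for deep observables** (Martinelli WM(Q_L, C, m) restricted to observables of support radius
`≤ L/2` placed at a centre `|u|_∞ ≤ L/4`, hence at depth `≥ L/4`): at large `β`, the finite-volume Wilson expectation of such a
species depends on the boundary condition only up to `C(A) e^{-m L}`, uniformly in `L`, `u`, `η`, `η'`. -/
def FlatBoxWeakMixingDeep : Prop :=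
  ∀ (G : Type) [Group G] [TopologicalSpace G] [IsTopologicalGroup G] [CompactSpace G],
    IsCompactSimpleLieGroup G → letI : MeasurableSpace G := borel G; haveI : BorelSpace G := ⟨rfl⟩;
    ∀ r : LatticeRep G, ∃ β₁ : ℝ, ∀ β : ℝ, β₁ ≤ β → ∃ m : ℝ, 0 < m ∧
      ∀ A : YMSpecies G, ∃ C : ℝ, ∀ (L : ℕ) (u : Site 4),
        (∀ i, |u i| ≤ (L : ℤ) / 4) → (∀ p ∈ A.supp, ∀ i, |p.1 i| ≤ (L : ℤ) / 2) →
        ∀ η η' : LGConfig 4 G,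
          |(∫ U, A.F (configShift (-u) U) ∂(ymSpecification (d := 4) r.ρ β (boxEdges L) η))
            - ∫ U, A.F (configShift (-u) U) ∂(ymSpecification (d := 4) r.ρ β (boxEdges L) η')|
            ≤ C * Real.exp (-(m * L))

/-- **Flat strong mixing for deep observables** (Martinelli SMT restricted to deep observables): at large `β`,
finite-volume Wilson covariances of two species (support radius `≤ L/2`) placed at centres `|u|_∞, |v|_∞ ≤ L/4` decay like
`C(A,B) e^{-m |u-v|₁}`, uniformly in the box size `L` and in the boundary condition `η`. -/
def FlatBoxStrongMixingDeep : Prop :=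
  ∀ (G : Type) [Group G] [TopologicalSpace G] [IsTopologicalGroup G] [CompactSpace G],
    IsCompactSimpleLieGroup G → letI : MeasurableSpace G := borel G; haveI : BorelSpace G := ⟨rfl⟩;
    ∀ r : LatticeRep G, ∃ β₁ : ℝ, ∀ β : ℝ, β₁ ≤ β → ∃ m : ℝ, 0 < m ∧
      ∀ A B : YMSpecies G, ∃ C : ℝ, ∀ (L : ℕ) (u v : Site 4),
        (∀ i, |u i| ≤ (L : ℤ) / 4) → (∀ i, |v i| ≤ (L : ℤ) / 4) →
        (∀ p ∈ A.supp, ∀ i, |p.1 i| ≤ (L : ℤ) / 2) → (∀ p ∈ B.supp, ∀ i, |p.1 i| ≤ (L : ℤ) / 2) →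
        ∀ η : LGConfig 4 G,
          let γ := ymSpecification (d := 4) r.ρ β (boxEdges L) η
          let a := fun U : LGConfig 4 G => A.F (configShift (-u) U)
          let b := fun U : LGConfig 4 G => B.F (configShift (-v) U)
          |(∫ U, a U * b U ∂γ) - (∫ U, a U ∂γ) * ∫ U, b U ∂γ|
            ≤ C * Real.exp (-(m * ((∑ i, |u i - v i| : ℤ) : ℝ)))

/-- **Card A, the line (statement only).** Flat deep mixing in both currencies gives in-chart uniformity on EVERY
admissible family: the chart product box `B_x × B_{x'}` is a flat `ℤ⁴` box of half-side `k/4` carrying the Wilson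
conditional law (DLR), in-chart observables sit `≥ k/16` from its boundary, and
`Cov = E[Cov(·,·|η)] + Cov(E[A|η], E[B|η])` is bounded by SMT-deep + (WM-deep)², with `K(A,B)` absorbing polynomial
prefactors. -/
def TollGateReduction : Prop := FlatBoxWeakMixingDeep → FlatBoxStrongMixingDeep → InChartUniformityR

/-- What the TYPED decl needs on top of the in-chart content: far pairs.  Believed FALSE for wild (periscope) cores
(crux idea `periscope-films`); true and idle after the recommended restate of 18154/18156 to in-chart pairs. -/
def FarPairClosure : Prop :=
  InChartUniformityR → Summit.QuantumFields.YangMills.Theses.HyperbolicRegulator.CurvatureUniformityR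

/-- Shape of Card A's line for the typed decl (trivial composition, `sorry`-free). -/
example (hT : TollGateReduction) (hF : FarPairClosure) (hW : FlatBoxWeakMixingDeep) (hS : FlatBoxStrongMixingDeep) :
    Summit.QuantumFields.YangMills.Theses.HyperbolicRegulator.CurvatureUniformityR :=
  hF (hT hW hS)

/-! ## Card B — Hilbertian (maximal-correlation) contraction along nested Markov shells -/

/-- **Two-step strong data processing along a Markov triple** (pure measure theory; the chain link of Card B).
If `m₁ ⊥ m₃ | m₂` (conditional-expectation form) and conditioning onto `m₂` contracts centred `m₁`- (resp. `m₃`-)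
measurable `L²` functions by `θ₁` (resp. `θ₂`), then `|E[f h]| ≤ θ₁ θ₂ ‖f‖₂ ‖h‖₂` for centred `f ∈ L²(m₁)`,
`h ∈ L²(m₃)`.  Iterated over `n` nested shells it gives `∏ θᵢ`. (Witsenhausen 1975; Peyre arXiv:1004.1602 Ch. 2.) -/
def SDPITwoStep : Prop :=
  ∀ (Ω : Type) (m₁ m₂ m₃ mΩ : MeasurableSpace Ω) (μ : @Measure Ω mΩ) [@IsProbabilityMeasure Ω mΩ μ]
    (θ₁ θ₂ : ℝ), m₁ ≤ mΩ → m₂ ≤ mΩ → m₃ ≤ mΩ → 0 ≤ θ₁ → 0 ≤ θ₂ →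
    (∀ f : Ω → ℝ, StronglyMeasurable[m₁] f → MemLp f 2 μ → μ[f|m₂ ⊔ m₃] =ᵐ[μ] μ[f|m₂]) →
    (∀ f : Ω → ℝ, StronglyMeasurable[m₁] f → MemLp f 2 μ → ∫ ω, f ω ∂μ = 0 →
        ∫ ω, (μ[f|m₂]) ω ^ 2 ∂μ ≤ θ₁ ^ 2 * ∫ ω, f ω ^ 2 ∂μ) →
    (∀ h : Ω → ℝ, StronglyMeasurable[m₃] h → MemLp h 2 μ → ∫ ω, h ω ∂μ = 0 →
        ∫ ω, (μ[h|m₂]) ω ^ 2 ∂μ ≤ θ₂ ^ 2 * ∫ ω, h ω ^ 2 ∂μ) →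
    ∀ f h : Ω → ℝ, StronglyMeasurable[m₁] f → StronglyMeasurable[m₃] h → MemLp f 2 μ → MemLp h 2 μ →
      ∫ ω, f ω ∂μ = 0 → ∫ ω, h ω ∂μ = 0 →
        |∫ ω, f ω * h ω ∂μ| ≤ θ₁ * θ₂ * Real.sqrt (∫ ω, f ω ^ 2 ∂μ) * Real.sqrt (∫ ω, h ω ^ 2 ∂μ)

/-- **Flat shell floor** (Card B's window, flat currency): at large `β` there are a shell width `w` and `θ < 1` such
that in every Wilson box with any boundary condition, any bounded observable of the edges INSIDE a sup-ball of radius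
`R` and any bounded observable of the edges OUTSIDE the concentric ball of radius `R + w` (the outer ball kept at depth
`≥ L/4`: a DEEP floor) have correlation coefficient at most `θ` — uniformly in `L`, `R`, the centre and `η` (shape-free in
the sense of Peyre: no dependence on the size of the supports). -/
def FlatShellFloor : Prop :=
  ∀ (G : Type) [Group G] [TopologicalSpace G] [IsTopologicalGroup G] [CompactSpace G],
    IsCompactSimpleLieGroup G → letI : MeasurableSpace G := borel G; haveI : BorelSpace G := ⟨rfl⟩;
    ∀ r : LatticeRep G, ∃ β₁ : ℝ, ∀ β : ℝ, β₁ ≤ β → ∃ w : ℕ, ∃ θ : ℝ, θ < 1 ∧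
      ∀ (L R : ℕ) (c : Site 4), (∀ i, |c i| + R + w ≤ 3 * (L : ℤ) / 4) →
      ∀ η : LGConfig 4 G, ∀ f g : LGConfig 4 G → ℝ, Measurable f → Measurable g →
        (∃ M, ∀ U, |f U| ≤ M) → (∃ M, ∀ U, |g U| ≤ M) →
        DependsOn f {e : ZdEdge 4 | ∀ i, |e.1 i - c i| ≤ R} →
        DependsOn g {e : ZdEdge 4 | ∃ i, (R : ℤ) + w < |e.1 i - c i|} →
        let γ := ymSpecification (d := 4) r.ρ β (boxEdges L) η
        |(∫ U, f U * g U ∂γ) - (∫ U, f U ∂γ) * ∫ U, g U ∂γ|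
          ≤ θ * Real.sqrt (∫ U, (f U - ∫ V, f V ∂γ) ^ 2 ∂γ) * Real.sqrt (∫ U, (g U - ∫ V, g V ∂γ) ^ 2 ∂γ)

/-- **Card B, flat deliverable (statement only).** The shell floor, iterated along `⌊|u-v|_∞ / (w+2)⌋` nested
concentric shells around `u` (Markov property of Wilson's finite-range specification + `SDPITwoStep`), gives flat strong
mixing for deep observables with `m = -log θ / (4(w+2))` (ℓ¹ vs sup metric) and `C = 2 ‖A‖_∞ ‖B‖_∞ / θ`: constants manifestly free of `L`. -/
def ShellChainGivesSMT : Prop := FlatShellFloor → FlatBoxStrongMixingDeep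

end Summit.QuantumFields.YangMills.Cruxes.CurvatureUniformityR.Ideate1

end
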